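import Summits.QuantumFields.YangMills.Theorems.LuscherReductionDressedRitzPolyakovLiftTransplantStatics
import Summits.QuantumFields.YangMills.Theorems.LuscherReductionTwistedTraceScalingCovariantCurl
import Literature.Analysis.OperatorTheory.YangMillsMatrixModelGroundStateSymmetry
import HarnessLib

/-!
# Line «polyakovlift» r6 on crux `DressedRitz` (stmt-QuantumFields-20205): S-STAT″ (o2) — transplanted observables inherit the SPATIAL PARITIES of the AL1
# eigenfunctions; separated pairs from axis transpositions and the parity `x ↦ −x`

Fleet-service module of seat ym-infvol-p1 g7 (holder of S-STAT `stub_liftStatics`, r6 `09c950a55cd7b1f3`).  The r5 symmetry certificates (`PairSeparated`, p545957) are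
keyed to the one-site LIFT SYMMETRIES `σ` (axis permutations `configPerm σp`, the parity `V ↦ V⁻¹`, …, all `IsLiftSymmetry`).  For the r6 observables
`g_i = (χ_R f_{i+1}/f_0) ∘ rootCoord L (Λ/2)` the action of `σ` is read through the root chart:

* §1 ★ chart equivariance: `rootCoord L μ (configPerm σp U) = S_π (rootCoord L μ U)` (`S_π` = row permutation `x_i ↦ x_{π⁻¹ i}` = Mathlib `piLpCongrLeft`) and
  `rootCoord L μ (V ↦ V⁻¹) = −rootCoord L μ V` (`gn(W⁻¹) = −gn(W)`);
* §2 ★ `transplantObsL_comp_of_equivariant` — if `f_0 ∘ S = f_0` and `f_{i+1} ∘ S = ε f_{i+1}` then `g_i ∘ σ = ε g_i` (`χ_R` is radial); `f_0` IS invariant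
  (Literature `groundState_rowPerm` / `groundState_neg`: uniqueness of the positive ground state);
* §3 ★★ `pairSeparated_transplantObsL_swap` / `pairSeparated_transplantObsL_parity` — a pair `(i, l)` with `f_{i+1}` EVEN and `f_{l+1}` ODD (or vice versa) under an
  axis transposition `x_a ↔ x_b`, resp. under `x ↦ −x`, is `PairSeparated` (clause (a), involutive lift symmetry);
* §4 ★★ `staticClauses_transplantL_of_parityCert` — S-STAT″ (both clauses, every `C ≥ 0`) for the transplant basis of an AL1 family EVERY PAIR of whose excited
  members is separated by a transposition- or parity-sign, `β ≥ 1`, `12·physLevel(k+1)·Λ < 1` (via `staticClauses_transplantL_of_pairSeparated`, p564073).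

HONEST FRAMING: fixed-lattice symmetry bookkeeping on the conditional femto rung R2b1; WHICH AL1 families are parity-separated (isotype content of the low levels of
`𝔥`) is an open ONE-type classification; the RG content of S-STAT″ above the first repeated isotype is untouched; not infinite volume, not a gap, not Clay.
References: M. Lüscher, NPB 219 (1983) 233 [cite: Luscher1983, §2–§3]; M. Lüscher, G. Münster, NPB 232 (1984) 445 [cite: LuscherMunster1984, §4];
M. Lüscher, U. Wolff, NPB 339 (1990) 222 [cite: LuscherWolff1990].
-/

set_option autoImplicit false

noncomputable section

open MeasureTheory Filter Topology Real
open Literature.MathematicalPhysics.QuantumFieldTheory (GaugeConfig Site gaugeTransform configPerm configPerm_apply sitePerm)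
open Literature.Analysis.OperatorTheory.YMMatrixModel
open scoped BigOperators

namespace Summit.QuantumFields.YangMills.Theorems.FemtoTransferGap.PolyakovLift

open Summit.QuantumFields.YangMills.Theorems.FemtoTransferGap
open Summit.QuantumFields.YangMills.Theorems.FemtoTransferGap.TwoLattice.Cov (scalarPart_inv vecPart_inv)

variable {k : ℕ}

/-! ## §1 Chart equivariance -/

/-- `gn(W⁻¹) = −gn(W)`. [cite: BrockerTomDieck1985, I (1.10)] -/
theorem gnLink_inv (W : SU2) (a : Fin 3) : gnLink W⁻¹ a = -gnLink W a := by
  rw [gnLink_apply, gnLink_apply, vecPart_inv, scalarPart_inv, Pi.neg_apply, neg_div]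

/-- On the one-point torus an axis permutation relabels the links: `(configPerm σp U)(e_i) = U(e_{π⁻¹ i})`. [folklore] -/
theorem configPerm_edgeOf (σp : Equiv.Perm (Fin 3)) (U : Cfg) (i : Fin 3) : configPerm σp U (edgeOf i) = U (edgeOf (σp.symm i)) := by
  rw [configPerm_apply]
  exact congrArg U (Prod.ext (Subsingleton.elim _ _) rfl)

/-- The gnomonic chart intertwines axis permutations with row permutations of `ℝ⁹`. [cite: Luscher1983, §2] -/
theorem gnCoord_configPerm (μ : ℝ) (σp : Equiv.Perm (Fin 3)) (U : Cfg) :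
    gnCoord μ (configPerm σp U) = LinearIsometryEquiv.piLpCongrLeft 2 ℝ ℝ (σp.prodCongr (Equiv.refl (Fin 3))) (gnCoord μ U) := by
  ext p
  rw [gnCoord_apply, rowPerm_apply, gnCoord_apply, configPerm_edgeOf]

/-- Row permutations permute the link norms. [folklore] -/
theorem linkNormSq_rowPerm (σp : Equiv.Perm (Fin 3)) (y : ZM) (i : Fin 3) :
    linkNormSq (LinearIsometryEquiv.piLpCongrLeft 2 ℝ ℝ (σp.prodCongr (Equiv.refl (Fin 3))) y) i = linkNormSq y (σp.symm i) := by
  unfold linkNormSq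
  exact Finset.sum_congr rfl fun a _ => by rw [rowPerm_apply]

/-- The root rescaling commutes with row permutations (it is radial per row). [folklore] -/
theorem rootRescale_rowPerm (L : ℕ) (μ : ℝ) (σp : Equiv.Perm (Fin 3)) (y : ZM) :
    rootRescale L μ (LinearIsometryEquiv.piLpCongrLeft 2 ℝ ℝ (σp.prodCongr (Equiv.refl (Fin 3))) y) =
      LinearIsometryEquiv.piLpCongrLeft 2 ℝ ℝ (σp.prodCongr (Equiv.refl (Fin 3))) (rootRescale L μ y) := by
  ext p
  rw [rootRescale_apply, rowPerm_apply, rowPerm_apply, rootRescale_apply, linkNormSq_rowPerm]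

/-- ★ **The root chart intertwines axis permutations with row permutations**: `rootCoord L μ (configPerm σp U) = S_π (rootCoord L μ U)`. [cite: Luscher1983, §2] -/
theorem rootCoord_configPerm (L : ℕ) (μ : ℝ) (σp : Equiv.Perm (Fin 3)) (U : Cfg) :
    rootCoord L μ (configPerm σp U) = LinearIsometryEquiv.piLpCongrLeft 2 ℝ ℝ (σp.prodCongr (Equiv.refl (Fin 3))) (rootCoord L μ U) := by
  unfold rootCoord
  rw [gnCoord_configPerm, rootRescale_rowPerm]

/-- The gnomonic chart sends link inversion to the parity of `ℝ⁹`. [cite: Luscher1983, §2] -/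
theorem gnCoord_linkInv (μ : ℝ) (U : Cfg) : gnCoord μ (fun e => (U e)⁻¹) = -gnCoord μ U := by
  ext p
  rw [gnCoord_apply, gnLink_inv, PiLp.neg_apply, gnCoord_apply, neg_div]

/-- Link norms are even. [folklore] -/
theorem linkNormSq_neg (y : ZM) (i : Fin 3) : linkNormSq (-y) i = linkNormSq y i := by
  unfold linkNormSq
  exact Finset.sum_congr rfl fun a _ => by rw [PiLp.neg_apply, neg_sq]

/-- The root rescaling is odd. [folklore] -/
theorem rootRescale_neg (L : ℕ) (μ : ℝ) (y : ZM) : rootRescale L μ (-y) = -rootRescale L μ y := by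
  ext p
  rw [rootRescale_apply, linkNormSq_neg, PiLp.neg_apply, PiLp.neg_apply, rootRescale_apply, mul_neg]

/-- ★ **The root chart sends link inversion to the parity**: `rootCoord L μ (V ↦ V⁻¹) = −rootCoord L μ V`. [cite: Luscher1983, §2] -/
theorem rootCoord_linkInv (L : ℕ) (μ : ℝ) (U : Cfg) : rootCoord L μ (fun e => (U e)⁻¹) = -rootCoord L μ U := by
  unfold rootCoord
  rw [gnCoord_linkInv, rootRescale_neg]

/-! ## §2 Transplanted observables inherit the parities of the AL1 eigenfunctions -/

/-- The radial cut-off depends on the norm only. [folklore] -/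
theorem radialCutoff_of_norm_eq (R : ℝ) {x y : ZM} (h : ‖x‖ = ‖y‖) : radialCutoff R x = radialCutoff R y := by
  unfold radialCutoff radialCutoffOne
  rw [norm_smul, norm_smul, h]

/-- ★ **Transfer lemma**: if the one-site map `σ` acts on the root chart through a norm-preserving `S` with `f_0 ∘ S = f_0` and `f_{i+1} ∘ S = ε·f_{i+1}`, then
`g_i ∘ σ = ε·g_i` for `g_i = transplantObsL L Λ R f i`. [cite: Luscher1983, §2–§3] -/
theorem transplantObsL_comp_of_equivariant {L : ℕ} {Λ R : ℝ} {f : Fin (k + 1) → ZM → ℝ} {i : Fin k} {σ : Cfg → Cfg} {S : ZM → ZM}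
    (hS : ∀ U, rootCoord L (Λ / 2) (σ U) = S (rootCoord L (Λ / 2) U)) (hnorm : ∀ y, ‖S y‖ = ‖y‖)
    (h0 : ∀ y, f 0 (S y) = f 0 y) {ε : ℝ} (hi : ∀ y, f i.succ (S y) = ε * f i.succ y) (U : Cfg) :
    transplantObsL L Λ R f i (σ U) = ε * transplantObsL L Λ R f i U := by
  show transplantFn R f i (rootCoord L (Λ / 2) (σ U)) = ε * transplantFn R f i (rootCoord L (Λ / 2) U)
  rw [hS]
  unfold transplantFn
  rw [radialCutoff_of_norm_eq R (hnorm _), h0, hi]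
  ring

/-- The ground state of an AL1 family with `f_0 > 0` is invariant under row permutations. [cite: Luscher1983, §2] [cite: ReedSimonIV1978, Thm. XIII.47–48] -/
theorem groundState_rowPerm_of_isEigenFamily {f : Fin (k + 1) → ZM → ℝ} (hf : IsEigenFamily k f) (hpos : ∀ x, 0 < f 0 x) (σp : Equiv.Perm (Fin 3)) (y : ZM) :
    f 0 (LinearIsometryEquiv.piLpCongrLeft 2 ℝ ℝ (σp.prodCongr (Equiv.refl (Fin 3))) y) = f 0 y := by
  obtain ⟨C, -, hC⟩ := (hf.2.2.2.2 0).exists_abs_le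
  have heig : ∀ x, hApply (f 0) x = physLevel 1 * f 0 x := fun x => by have h := hf.2.2.2.1 0 x; simpa using h
  have hnorm : ∫ x, f 0 x * f 0 x = (1 : ℝ) := by have h := hf.2.2.1 0 0; rwa [if_pos rfl] at h
  exact groundState_rowPerm σp (contDiff_two_of_forall (hf.1 0)) (hf.2.1 0) heig ⟨C, hC⟩ hnorm hpos y

/-- The ground state of an AL1 family with `f_0 > 0` is even. [cite: Luscher1983, §2] [cite: ReedSimonIV1978, Thm. XIII.47–48] -/
theorem groundState_neg_of_isEigenFamily {f : Fin (k + 1) → ZM → ℝ} (hf : IsEigenFamily k f) (hpos : ∀ x, 0 < f 0 x) (y : ZM) : f 0 (-y) = f 0 y := by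
  obtain ⟨C, -, hC⟩ := (hf.2.2.2.2 0).exists_abs_le
  have heig : ∀ x, hApply (f 0) x = physLevel 1 * f 0 x := fun x => by have h := hf.2.2.2.1 0 x; simpa using h
  have hnorm : ∫ x, f 0 x * f 0 x = (1 : ℝ) := by have h := hf.2.2.1 0 0; rwa [if_pos rfl] at h
  exact groundState_neg (contDiff_two_of_forall (hf.1 0)) (hf.2.1 0) heig ⟨C, hC⟩ hnorm hpos y

/-! ## §3 Separated pairs from parity data -/

/-- An axis transposition is an involution of the one-site configurations. [folklore] -/
theorem configPerm_swap_swap (a b : Fin 3) (V : Cfg) : configPerm (Equiv.swap a b) (configPerm (Equiv.swap a b) V) = V := by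
  funext e
  rw [configPerm_apply, configPerm_apply, Equiv.symm_swap, Equiv.swap_apply_self]
  congr 1
  exact Prod.ext (Subsingleton.elim _ _) rfl

/-- ★★ **Transposition-separated pairs are `PairSeparated`.**  For an AL1 family with `f_0 > 0`: if `f_{i+1}` is EVEN and `f_{l+1}` ODD under the row transposition
`x_a ↔ x_b` (or vice versa), the transplanted channels `g_i, g_l` are separated by the lift symmetry `configPerm (swap a b)` (exactly uncorrelated in every fine
theory). [cite: Luscher1983, §2–§3] [cite: LuscherWolff1990] -/
theorem pairSeparated_transplantObsL_swap (L : ℕ) (Λ R : ℝ) {f : Fin (k + 1) → ZM → ℝ} (hf : IsEigenFamily k f) (hpos : ∀ x, 0 < f 0 x)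
    (a b : Fin 3) {i l : Fin k}
    (hsign : ((∀ y, f i.succ (LinearIsometryEquiv.piLpCongrLeft 2 ℝ ℝ ((Equiv.swap a b).prodCongr (Equiv.refl (Fin 3))) y) = f i.succ y) ∧
        (∀ y, f l.succ (LinearIsometryEquiv.piLpCongrLeft 2 ℝ ℝ ((Equiv.swap a b).prodCongr (Equiv.refl (Fin 3))) y) = -f l.succ y)) ∨
      ((∀ y, f l.succ (LinearIsometryEquiv.piLpCongrLeft 2 ℝ ℝ ((Equiv.swap a b).prodCongr (Equiv.refl (Fin 3))) y) = f l.succ y) ∧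
        (∀ y, f i.succ (LinearIsometryEquiv.piLpCongrLeft 2 ℝ ℝ ((Equiv.swap a b).prodCongr (Equiv.refl (Fin 3))) y) = -f i.succ y))) :
    PairSeparated (transplantObsL L Λ R f i) (transplantObsL L Λ R f l) := by
  set S := LinearIsometryEquiv.piLpCongrLeft 2 ℝ ℝ ((Equiv.swap a b).prodCongr (Equiv.refl (Fin 3))) with hSdef
  have hS : ∀ U : Cfg, rootCoord L (Λ / 2) (configPerm (Equiv.swap a b) U) = S (rootCoord L (Λ / 2) U) := fun U => rootCoord_configPerm L (Λ / 2) _ U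
  have hnorm : ∀ y, ‖S y‖ = ‖y‖ := fun y => S.norm_map y
  have h0 : ∀ y, f 0 (S y) = f 0 y := fun y => groundState_rowPerm_of_isEigenFamily hf hpos _ y
  refine Or.inl ⟨fun V => configPerm (Equiv.swap a b) V, isLiftSymmetry_configPerm _, configPerm_swap_swap a b, ?_⟩
  rcases hsign with ⟨hi, hl⟩ | ⟨hl, hi⟩
  · refine Or.inl ⟨fun V => ?_, fun V => ?_⟩
    · have := transplantObsL_comp_of_equivariant (R := R) hS hnorm h0 (ε := 1) (fun y => by rw [hi y, one_mul]) V
      rw [this, one_mul]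
    · have := transplantObsL_comp_of_equivariant (R := R) hS hnorm h0 (ε := -1) (fun y => by rw [hl y, neg_one_mul]) V
      rw [this, neg_one_mul]
  · refine Or.inr ⟨fun V => ?_, fun V => ?_⟩
    · have := transplantObsL_comp_of_equivariant (R := R) hS hnorm h0 (ε := 1) (fun y => by rw [hl y, one_mul]) V
      rw [this, one_mul]
    · have := transplantObsL_comp_of_equivariant (R := R) hS hnorm h0 (ε := -1) (fun y => by rw [hi y, neg_one_mul]) V
      rw [this, neg_one_mul]

/-- ★★ **Parity-separated pairs are `PairSeparated`**: if `f_{i+1}` is EVEN and `f_{l+1}` ODD under `x ↦ −x` (or vice versa), the transplanted channels are separated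
by the intrinsic parity `V ↦ V⁻¹`. [cite: Luscher1983, §2–§3] [cite: LuscherWolff1990] -/
theorem pairSeparated_transplantObsL_parity (L : ℕ) (Λ R : ℝ) {f : Fin (k + 1) → ZM → ℝ} (hf : IsEigenFamily k f) (hpos : ∀ x, 0 < f 0 x)
    {i l : Fin k}
    (hsign : ((∀ y, f i.succ (-y) = f i.succ y) ∧ (∀ y, f l.succ (-y) = -f l.succ y)) ∨
      ((∀ y, f l.succ (-y) = f l.succ y) ∧ (∀ y, f i.succ (-y) = -f i.succ y))) :
    PairSeparated (transplantObsL L Λ R f i) (transplantObsL L Λ R f l) := by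
  have hS : ∀ U : Cfg, rootCoord L (Λ / 2) (fun e => (U e)⁻¹) = (fun y : ZM => -y) (rootCoord L (Λ / 2) U) := fun U => rootCoord_linkInv L (Λ / 2) U
  have hnorm : ∀ y : ZM, ‖(fun y : ZM => -y) y‖ = ‖y‖ := fun y => norm_neg y
  have h0 : ∀ y, f 0 ((fun y : ZM => -y) y) = f 0 y := fun y => groundState_neg_of_isEigenFamily hf hpos y
  refine Or.inl ⟨fun V e => (V e)⁻¹, isLiftSymmetry_linkInv, fun V => by simp, ?_⟩
  rcases hsign with ⟨hi, hl⟩ | ⟨hl, hi⟩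
  · refine Or.inl ⟨fun V => ?_, fun V => ?_⟩
    · have := transplantObsL_comp_of_equivariant (R := R) hS hnorm h0 (ε := 1) (fun y => by rw [hi y, one_mul]) V
      rw [this, one_mul]
    · have := transplantObsL_comp_of_equivariant (R := R) hS hnorm h0 (ε := -1) (fun y => by rw [hl y, neg_one_mul]) V
      rw [this, neg_one_mul]
  · refine Or.inr ⟨fun V => ?_, fun V => ?_⟩
    · have := transplantObsL_comp_of_equivariant (R := R) hS hnorm h0 (ε := 1) (fun y => by rw [hl y, one_mul]) V
      rw [this, one_mul]
    · have := transplantObsL_comp_of_equivariant (R := R) hS hnorm h0 (ε := -1) (fun y => by rw [hi y, neg_one_mul]) V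
      rw [this, neg_one_mul]

/-! ## §4 ★★ S-STAT″ for parity-separated AL1 families -/

/-- ★★ **Both static clauses, every `C ≥ 0`, for the transplant basis of an AL1 family every pair of whose excited members is separated by a transposition-sign or a
parity-sign** (`β ≥ 1`, `Λ > 0`, `12·physLevel(k+1)·Λ < 1`, `1 ≤ R`, `1/8 ≤ RΛ ≤ 1/4`, any raw vacuum, any fine lattice). [cite: Luscher1983, §3] [cite: LuscherWolff1990] -/
theorem staticClauses_transplantL_of_parityCert {L : ℕ} [NeZero L] {β : ℝ} (hβ : 1 ≤ β) {φ : GaugeConfig 3 L SU2 → ℝ} (hvac : IsRawVacuum β φ)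
    {Λ R : ℝ} (hΛ : 0 < Λ) (hΛk : 12 * physLevel (k + 1) * Λ < 1) (hR1 : 1 ≤ R) (hlo : 1 / 8 ≤ R * Λ) (hhi : R * Λ ≤ 1 / 4)
    {f : Fin (k + 1) → ZM → ℝ} (hf : IsEigenFamily k f) (hpos : ∀ x, 0 < f 0 x)
    (hcert : ∀ i l : Fin k, i ≠ l →
      (∃ a b : Fin 3,
        ((∀ y, f i.succ (LinearIsometryEquiv.piLpCongrLeft 2 ℝ ℝ ((Equiv.swap a b).prodCongr (Equiv.refl (Fin 3))) y) = f i.succ y) ∧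
            (∀ y, f l.succ (LinearIsometryEquiv.piLpCongrLeft 2 ℝ ℝ ((Equiv.swap a b).prodCongr (Equiv.refl (Fin 3))) y) = -f l.succ y)) ∨
          ((∀ y, f l.succ (LinearIsometryEquiv.piLpCongrLeft 2 ℝ ℝ ((Equiv.swap a b).prodCongr (Equiv.refl (Fin 3))) y) = f l.succ y) ∧
            (∀ y, f i.succ (LinearIsometryEquiv.piLpCongrLeft 2 ℝ ℝ ((Equiv.swap a b).prodCongr (Equiv.refl (Fin 3))) y) = -f i.succ y))) ∨
      (((∀ y, f i.succ (-y) = f i.succ y) ∧ (∀ y, f l.succ (-y) = -f l.succ y)) ∨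
        ((∀ y, f l.succ (-y) = f l.succ y) ∧ (∀ y, f i.succ (-y) = -f i.succ y))))
    {C : ℝ} (hC : 0 ≤ C) :
    StaticClauses k C β (dressedLiftFamily β φ (fun i => transplantObsL L Λ R f i)) := by
  have hbasis : TransplantBasisL k L Λ (fun i => transplantObsL L Λ R f i) := ⟨f, R, hf, hpos, hR1, hlo, hhi, fun _ => rfl⟩
  refine staticClauses_transplantL_of_pairSeparated hβ hvac hΛ hΛk hbasis (fun i l hil => ?_) hC
  rcases hcert i l hil with ⟨a, b, hab⟩ | hpar
  · exact pairSeparated_transplantObsL_swap L Λ R hf hpos a b hab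
  · exact pairSeparated_transplantObsL_parity L Λ R hf hpos hpar

end Summit.QuantumFields.YangMills.Theorems.FemtoTransferGap.PolyakovLift

end
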